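import Summits.QuantumFields.YangMills.Theorems.BalabanUVNodesN14ClassLawRoadsZeroDialAtSpineReadingOfRecord13CoPHV

/-!
# BalabanUVNodes ∕ N14 — THE LOCATED N14 WORD IN KERNEL FORM: on node U3's class-measure road (iii) N14's (I)-binder `TiltedMeanMatching` AT THE V SPINE READING OF RECORD is a
# COROLLARY of the one-constant class-law sentence NE7-S_cl (NE7-S_cl ⇒ TV_cl ⇒ binder), at any dial and at the zero dial — node N14 = NE1′ adds no letter to stub 2

Cell `pub-ymgap` (HUMAN RULING D-0062 Track A; director-ym №197 ∕ HUMAN RULING D-0149), WIDTH SEAT `pub-ymgap-dag-n14-w2` (g3), ASK-NEXT OFFER (o1) (bus l.28153, 2026-08-28T03:22Z; default absent a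
word).  Filed `--kind proof --supports stmt-QuantumFields-20544 --as helper` (K3⁷ `SpineGivenEndpointR13SepCoPH`, skeleton v4 17c74fac127b5f61).  COUNT-NEUTRAL.  THEOREMS ONLY (0 `def`); imports
this seat's FILE 2 `…N14ClassLawRoadsZeroDialAtSpineReadingOfRecord13CoPHV` (p601321; through it FILE 1 p599679, g2's `…V.tiltedMeanMatching_crOfRecord₁₃VAt_of_tv` p596111, g2's `classMeasA₁₃ ∕ B₁₃`,
dag-n19-c's `N19CoreTVInvariant.tvSandwich_of_classSandwich` p504410) — BY NAME; edits nothing; `N`-∕`K₀`-generic; no Theses import.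

WHY.  FILE 1 ∕ FILE 2 read K3⁷ v4 stub 2's N19′ conjunct at `crOfRecord₁₃VAt` on node U3's class-law roads WITHOUT node N14's (I)-binder (dag-n19-c: «NO (I)-binder, NO mean-value step»), and
stated the located N14 word in prose: under director-ym №195 (8) reading (a) node N14 = NE1′ («dressed stability, observable-attached, μ-uniform») owes nothing at stub 2 beyond node U3's
sentence.  This file is that word as two kernel implications: the same U3 sentence that closes the N19′ conjunct ALSO yields N14's binder at the reading — so the binder is DOWNSTREAM of
U3 on every road, never an independent input.
* §1 ★ `tiltedMeanMatching_crOfRecord₁₃VAt_of_classSandwich` — at one Stage-13 tuple with core provisos (law (H-ζ) displayed), any cut `jcut`, any shell split `sh`: NE7-S_cl of width `r K ≥ 0`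
  for the FULL class laws of record pushed to the unit lattice on every good key ⇒ `TiltedMeanMatching (cr…).l₀ (cr…).T (cr…).Bad (prodObs … (K₀+K) os) classMeasA₁₃ (prodObs … (K₀+K+1) os)
  classMeasB₁₃ (K ↦ 4·e^{2 l₀}·(e^{2 r K} − 1))` at `cr := crOfRecord₁₃VAt K₀ jcut sh …` (n19-c `tvSandwich_of_classSandwich` on the common unit lattice + g2 V §1 `…_of_tv`).
* §2 ★ `tiltedMeanMatching_crOfRecord₁₃VAt_cutZero_of_classSandwich` — the zero-cut edition from FILE 2's t-FREE ALL-KEYS sentence (an all-keys sentence implies the windowed one for ANY bad class).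
Rates compare: SHAPE-density `r` gives `e^{2r} − 1` directly (g2 V §1 `…_of_shapeDensity`, dag-n14-w3 sharp `2·tanh(r∕2)`); via TV the one-constant sandwich pays the factor `4e^{2l₀}` — constants only.

HONEST FRAMING.  By-name bookkeeping ([folklore]); NE7-S_cl is node U3's UNPRINTED two-run statement for d = 4, produced by nobody; the pin ∕ laws are displayed, claimed for no tuple (K0⁷
OPEN); nothing of Bałaban's is asserted; NE7 ∕ NE1′ NOT PRINTED ∕ NOT PROVED; N14 ∕ N19 NOT discharged; K3⁷ OPEN, NOT claimed; counts UNMOVED (typed 28∕28 · discharged 5∕27, A 5∕28); one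
finite four-torus programme at fixed `ε = L^{−K}` — the YM mass gap (Clay) is NOT proved by any of this: R4 closes only the conditional finite-𝕋⁴ rung `BalabanLadder.UV`; NOT ℝ⁴, NOT OS, NOT
a mass gap, NOT Clay.  0 `def`, 0 `sorry`, standard axioms; no decl below carries a cite tag.
-/

set_option autoImplicit false

noncomputable section

open MeasureTheory ProbabilityTheory Finset
open scoped ENNReal BigOperators Matrix.Norms.L2Operator

namespace YMDAG.N14.AtSpineReading13CoPH.V.ClassLawRoads.Binder

open Literature.MathematicalPhysics.QuantumFieldTheory.Balaban1983to89
open Literature.MathematicalPhysics.QuantumFieldTheory.Balaban1983to89.T4Continuum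
open Literature.MathematicalPhysics.QuantumFieldTheory.Balaban1983to89.Node00
open B14.Eq218Concrete
open Summit.QuantumFields.BalabanUV.T4Continuum.Spine
open Summit.QuantumFields.BalabanUV.T4Continuum.NE1p.DressedMGFForm (MGFForm TiltedMeanMatching)
open Summit.QuantumFields.YangMills.BalabanUVNodes.N19CoreTVInvariant (tvSandwich_of_classSandwich)
open YMDAG.UVSplit hiding SU
open YMDAG.N14.AtSpineReading13CoPH
open YMDAG.N14.AtSpineReading13CoPH.V (tiltedMeanMatching_crOfRecord₁₃VAt_of_tv)

variable {F : T4Family} {N : ℕ} [NeZero N] (θ : Stage13HParams F N) (hP : θ.Provisos₁₃CoPH F N) (K₀ : ℕ) (jcut : ℕ → ℕ) (sh : ShellSplit₁₃CoPH N K₀)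

/-! ## §1 NE7-S_cl ⇒ N14's binder at the V reading (any dial) -/

/-- **★ N14's (I)-BINDER AT THE V READING OF RECORD IS A COROLLARY OF NODE U3's ONE-CONSTANT CLASS-MEASURE SENTENCE.**  At one Stage-13 tuple with core provisos (law (H-ζ)
displayed), any cut `jcut`, any shell split `sh`: IF for every `K` ONE constant `c` sandwiches the FULL class laws of record pushed to the unit lattice — `e^{c − r K}·(classMeasA₁₃ K x).map
A_{K₀+K} ≤ (classMeasB₁₃ K x).map A_{K₀+K+1} ≤ e^{c + r K}·…` AS MEASURES on every good key `x ∈ classSet₁₃ K ∖ badClass₁₃ jcut K t`, `|t| ≤ 1`, `0 ≤ r K` — THEN N14's binder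
`TiltedMeanMatching` holds at `crOfRecord₁₃VAt K₀ jcut sh …`'s `l₀ ∕ T ∕ Bad` for the record's observables and class measures with `η K = 4·e^{2 l₀}·(e^{2 r K} − 1)` (dag-n19-c
`tvSandwich_of_classSandwich` on the common unit lattice, finite pushed-forward pieces; then g2 V §1 `tiltedMeanMatching_crOfRecord₁₃VAt_of_tv`).  The binder is DOWNSTREAM of U3. [folklore] -/
theorem tiltedMeanMatching_crOfRecord₁₃VAt_of_classSandwich (hζm : ZetaMeasurable F N θ.ζ) (g₀ : ℕ → ℝ) (os : List (ULoop F)) {r : ℕ → ℝ} (hr : ∀ K, 0 ≤ r K)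
    (hS : letI : DecidableEq (Σ K, SiteSeqKey F (K₀ + K)) := Classical.decEq _
      ∀ K : ℕ, ∃ c : ℝ, ∀ t : ℝ, |t| ≤ 1 → ∀ x ∈ classSet₁₃ θ K₀ g₀ K \ badClass₁₃ θ K₀ g₀ jcut K t,
        ENNReal.ofReal (Real.exp (c - r K)) • (classMeasA₁₃ θ K₀ g₀ K x).map ((T4RunLadder.unitFactorisation (datumOfRecord₁₃CoPH F N θ hP) (isPrintedAveraged_datumOfRecord₁₃CoPH F N θ hP).avgMeasurable g₀).A (K₀ + K)) ≤ (classMeasB₁₃ θ K₀ g₀ K x).map ((T4RunLadder.unitFactorisation (datumOfRecord₁₃CoPH F N θ hP) (isPrintedAveraged_datumOfRecord₁₃CoPH F N θ hP).avgMeasurable g₀).A (K₀ + K + 1)) ∧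
        (classMeasB₁₃ θ K₀ g₀ K x).map ((T4RunLadder.unitFactorisation (datumOfRecord₁₃CoPH F N θ hP) (isPrintedAveraged_datumOfRecord₁₃CoPH F N θ hP).avgMeasurable g₀).A (K₀ + K + 1)) ≤ ENNReal.ofReal (Real.exp (c + r K)) • (classMeasA₁₃ θ K₀ g₀ K x).map ((T4RunLadder.unitFactorisation (datumOfRecord₁₃CoPH F N θ hP) (isPrintedAveraged_datumOfRecord₁₃CoPH F N θ hP).avgMeasurable g₀).A (K₀ + K))) :
    letI := (crOfRecord₁₃VAt K₀ jcut sh F θ hP g₀ os).dec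
    TiltedMeanMatching (crOfRecord₁₃VAt K₀ jcut sh F θ hP g₀ os).l₀ (crOfRecord₁₃VAt K₀ jcut sh F θ hP g₀ os).T (crOfRecord₁₃VAt K₀ jcut sh F θ hP g₀ os).Bad
      (fun K (U : GaugeField (F.P (K₀ + K)) 0 (Node00.SU N)) => T4GenFunBounds.prodObs ((datumOfRecord₁₃CoPH F N θ hP).scheme g₀) (K₀ + K) os U) (classMeasA₁₃ θ K₀ g₀)
      (fun K (U : GaugeField (F.P (K₀ + K + 1)) 0 (Node00.SU N)) => T4GenFunBounds.prodObs ((datumOfRecord₁₃CoPH F N θ hP).scheme g₀) (K₀ + K + 1) os U) (classMeasB₁₃ θ K₀ g₀)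
      fun K => 4 * Real.exp (2 * (crOfRecord₁₃VAt K₀ jcut sh F θ hP g₀ os).l₀) * (Real.exp (2 * r K) - 1) := by
  letI : DecidableEq (Σ K, SiteSeqKey F (K₀ + K)) := Classical.decEq _
  set Nf := (T4RunLadder.unitFactorisation (datumOfRecord₁₃CoPH F N θ hP) (isPrintedAveraged_datumOfRecord₁₃CoPH F N θ hP).avgMeasurable g₀) with hNf
  have hTV := tvSandwich_of_classSandwich (Ω := fun _ => GaugeField (F.P 0) 0 (Node00.SU N)) (T := classSet₁₃ θ K₀ g₀) (Bad := badClass₁₃ θ K₀ g₀ jcut) (l₀ := 1) (r₂ := r)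
    (μA := fun K x => Measure.map (α := GaugeField (F.P (K₀ + K)) 0 (Node00.SU N)) (Nf.A (K₀ + K)) (classMeasA₁₃ θ K₀ g₀ K x))
    (μB := fun K x => Measure.map (α := GaugeField (F.P (K₀ + K + 1)) 0 (Node00.SU N)) (Nf.A (K₀ + K + 1)) (classMeasB₁₃ θ K₀ g₀ K x))
    (fun K x _ => by haveI := isFiniteMeasure_classMeasA₁₃ θ K₀ hP hζm g₀ K x; infer_instance) hr hS
  exact tiltedMeanMatching_crOfRecord₁₃VAt_of_tv θ hP K₀ jcut sh hζm g₀ os hTV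

/-! ## §2 The zero-cut edition from the t-free all-keys sentence -/

/-- **★ THE ZERO-CUT EDITION** — FILE 2's t-FREE ALL-KEYS class-measure sentence on the FULL class laws of record (no class excused), `0 ≤ r K` ⇒ N14's binder at `crOfRecord₁₃VAt K₀ (fun _ ↦ 0)
sh …` (any shell split `sh`): an all-keys sentence implies §1's windowed hypothesis for any bad class (a bad class only removes obligations; at the zero cut it is empty anyway,
dag-n20-w2 `badClass₁₃_cutZero`). [folklore] -/
theorem tiltedMeanMatching_crOfRecord₁₃VAt_cutZero_of_classSandwich (sh : ShellSplit₁₃CoPH N K₀) (hζm : ZetaMeasurable F N θ.ζ) (g₀ : ℕ → ℝ) (os : List (ULoop F)) {r : ℕ → ℝ}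
    (hr : ∀ K, 0 ≤ r K)
    (hS : letI : DecidableEq (Σ K, SiteSeqKey F (K₀ + K)) := Classical.decEq _
      ∀ K : ℕ, ∃ c : ℝ, ∀ x ∈ classSet₁₃ θ K₀ g₀ K,
        ENNReal.ofReal (Real.exp (c - r K)) • (classMeasA₁₃ θ K₀ g₀ K x).map ((T4RunLadder.unitFactorisation (datumOfRecord₁₃CoPH F N θ hP) (isPrintedAveraged_datumOfRecord₁₃CoPH F N θ hP).avgMeasurable g₀).A (K₀ + K)) ≤ (classMeasB₁₃ θ K₀ g₀ K x).map ((T4RunLadder.unitFactorisation (datumOfRecord₁₃CoPH F N θ hP) (isPrintedAveraged_datumOfRecord₁₃CoPH F N θ hP).avgMeasurable g₀).A (K₀ + K + 1)) ∧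
        (classMeasB₁₃ θ K₀ g₀ K x).map ((T4RunLadder.unitFactorisation (datumOfRecord₁₃CoPH F N θ hP) (isPrintedAveraged_datumOfRecord₁₃CoPH F N θ hP).avgMeasurable g₀).A (K₀ + K + 1)) ≤ ENNReal.ofReal (Real.exp (c + r K)) • (classMeasA₁₃ θ K₀ g₀ K x).map ((T4RunLadder.unitFactorisation (datumOfRecord₁₃CoPH F N θ hP) (isPrintedAveraged_datumOfRecord₁₃CoPH F N θ hP).avgMeasurable g₀).A (K₀ + K))) :
    letI := (crOfRecord₁₃VAt K₀ (fun _ => 0) sh F θ hP g₀ os).dec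
    TiltedMeanMatching (crOfRecord₁₃VAt K₀ (fun _ => 0) sh F θ hP g₀ os).l₀ (crOfRecord₁₃VAt K₀ (fun _ => 0) sh F θ hP g₀ os).T (crOfRecord₁₃VAt K₀ (fun _ => 0) sh F θ hP g₀ os).Bad
      (fun K (U : GaugeField (F.P (K₀ + K)) 0 (Node00.SU N)) => T4GenFunBounds.prodObs ((datumOfRecord₁₃CoPH F N θ hP).scheme g₀) (K₀ + K) os U) (classMeasA₁₃ θ K₀ g₀)
      (fun K (U : GaugeField (F.P (K₀ + K + 1)) 0 (Node00.SU N)) => T4GenFunBounds.prodObs ((datumOfRecord₁₃CoPH F N θ hP).scheme g₀) (K₀ + K + 1) os U) (classMeasB₁₃ θ K₀ g₀)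
      fun K => 4 * Real.exp (2 * (crOfRecord₁₃VAt K₀ (fun _ => 0) sh F θ hP g₀ os).l₀) * (Real.exp (2 * r K) - 1) := by
  letI : DecidableEq (Σ K, SiteSeqKey F (K₀ + K)) := Classical.decEq _
  refine tiltedMeanMatching_crOfRecord₁₃VAt_of_classSandwich θ hP K₀ (fun _ => 0) sh hζm g₀ os hr fun K => ?_
  obtain ⟨c, hc⟩ := hS K
  exact ⟨c, fun t _ x hx => hc x (Finset.mem_sdiff.1 hx).1⟩

end YMDAG.N14.AtSpineReading13CoPH.V.ClassLawRoads.Binder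

end
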